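import Mathlib
import Summits.Ventures.PercRepro2.HCovSwap
import Summits.Ventures.PercRepro2.RootLeafA3Events

/-!
# (HCOV) when a ROOT is a leaf at `a₃` (blind cell PercRepro2, p4 g0; S3 GAP (G4), the first
root-leaf class: proofs/subclaims/S3-CLASSES.md §S3.4 (e))

Let the root `a₁` be a LEAF attached to `a₃` by the single edge `f` of weight `q = p f`, with
`a₂, o, b ≠ a₁` (`G − a₁` arbitrary).  Write `Q¹ = {a₃ ↮ a₂}` for the `Q`-event of the instance
`a₁ := a₃` on `G − a₁` (`avoidAll ends a₂ {a₃}`), `Z = P(Q¹)`, and `C(X, Y)` for the cleared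
covariance `covC p ends a₃ a₂ X Y = Z·P(Q¹ ∩ X ∩ Y) − P(Q¹ ∩ X)·P(Q¹ ∩ Y)` of `PendantRoot.lean`
with the roots `(a₃, a₂)`.

* With `f` closed the root `a₁` is isolated: `Q` is sure, `C₁ = {a₁}`, `PD = Q¹`, `T = {a₂ ↔ a₃}`,
  `T′ = ∅` — the one-root world, where `Gc = 0` (the (ONE-ROOT) zero).  With `f` open `a₁ ≡ a₃`:
  `Q = Q¹`, `PD = T = ∅`, `T′ = Q¹` — the coincidence `a₁ = a₃`, where `Gc = 0` again
  (`RootCoincidence.Gc_a3_eq_a1`).  Every mass of `Gc` is the `q`-mixture of its two world values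
  (`prob_split`, RootLeafA3Events.lean — which carries the pointwise two-world lemmas and the `Q`/`PD` atoms; this file carries the `T`/`T′` atoms, the decomposition of the free masses over `Q¹ ⊔ {a₂ ↔ a₃}`, the identity and the theorem), so `Gc` is a cubic in `q` vanishing at `0` and at `1`.
* **`Gc_root_leaf_a3`** (exact identity, a polynomial identity after the mass rewrites):

  `Gc = 2 q (1 − q) (1 − q + q Z) · [ C(oH, bH) − C(oH, bL) ]`,

  `oH = {a₂ ↔ o}`, `bH = {a₂ ↔ b}`, `bL = {a₃ ↔ b}` — i.e. the two `q`-Bernstein coefficients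
  `U = 2[C(oH,bH) − C(oH,bL)]` and `V = Z·U` of the cubic coincide up to the factor `Z`.
* **`HCov_root_leaf_a3`**: `C(oH, bH) ≥ 0` is BHK06 Thm 1.3 (same cluster `C(a₂)` given
  `a₃ ∉ C(a₂)`; `PendantRoot.covC_same_nonneg` at the roots `(a₂, a₃)`) and `C(oH, bL) ≤ 0` is
  BHK06 Thm 1.4 (cross cluster; `PendantRoot.covC_cross_nonpos`), hence (HCOV) holds at every
  labelled instance whose root `a₁` is a leaf at `a₃`, for every weight of the leaf edge; by the
  root symmetry `Gc_swap` the same holds for `a₂` a leaf at `a₃` (`HCov_root_leaf_a3'`).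
  Own exact checks (work/rootleaf_formula.py): the identity on 43 / 43 random instances
  `n ≤ 7`, weights `k/8`; the cubic's coefficients on 274 / 274 instances, 0 negative.
-/

namespace Summit.Ventures.PercRepro2

open UnionCluster CovForm PendantRoot

namespace RootLeafA3

variable {V : Type*} {E : Type*} [Fintype E] [DecidableEq E] {R : Type*} [Field R]
  [LinearOrder R] [IsStrictOrderedRing R]

section Atoms

variable (p : E → R) {ends : E → Sym2 V} {f : E} {a₁ a₃ : V} (hf : ends f = s(a₁, a₃))
  (hleaf : ∀ e, a₁ ∈ ends e → e = f) (h13 : a₁ ≠ a₃) {a₂ : V} (h12 : a₁ ≠ a₂)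

include hf hleaf h13 h12

omit [LinearOrder R] [IsStrictOrderedRing R] in
/-- `P(T ∩ X) = (1 − q) P({a₂ ↔ a₃} ∩ X)` for free `X`. -/
lemma prob_T_inter {X : Set (Config E)} (hX : Free f X) :
    prob p (TEvent ends a₁ a₂ a₃ ∩ X) = (1 - p f) * prob p (connEvent ends a₂ a₃ ∩ X) := by
  have h := prob_split p (A := TEvent ends a₁ a₂ a₃ ∩ X) (A₁ := ∅) (by intro ω ω' _; rfl)
    ((free_connEvent hf hleaf h13 (Ne.symm h12) h13.symm).inter hX) ?_ ?_
  · rw [h, prob_empty, mul_zero, zero_add]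
  · ext ω
    simp only [Set.mem_inter_iff, mem_openEdge, Set.mem_empty_iff_false, false_and, iff_false,
      not_and]
    intro h hω
    exact mem_T_open hf a₂ hω h.1
  · ext ω
    simp only [Set.mem_inter_iff, mem_closedEdge]
    constructor <;> rintro ⟨h, hω⟩ <;>
      exact ⟨by simpa only [mem_T_closed hf hleaf h13 h12 hω] using h, hω⟩

omit [LinearOrder R] [IsStrictOrderedRing R] in
/-- `P(T) = (1 − q) P(a₂ ↔ a₃)`. -/
lemma prob_T : prob p (TEvent ends a₁ a₂ a₃) = (1 - p f) * prob p (connEvent ends a₂ a₃) := by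
  have h := prob_T_inter p hf hleaf h13 h12 (X := Set.univ) (by intro ω ω' _; rfl)
  simpa only [Set.inter_univ] using h

omit [LinearOrder R] [IsStrictOrderedRing R] h12 in
/-- `P(T ∩ {a₁ ↔ v} ∩ X) = 0` (`v ≠ a₁`). -/
lemma prob_T_inter_L {v : V} (hv : v ≠ a₁) (X : Set (Config E)) :
    prob p (TEvent ends a₁ a₂ a₃ ∩ (connEvent ends a₁ v ∩ X)) = 0 := by
  have h := prob_split p (f := f) (A := TEvent ends a₁ a₂ a₃ ∩ (connEvent ends a₁ v ∩ X)) (A₁ := ∅)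
    (A₀ := ∅) (by intro ω ω' _; rfl) (by intro ω ω' _; rfl) ?_ ?_
  · rw [h, prob_empty]; ring
  · ext ω
    simp only [Set.mem_inter_iff, mem_openEdge, Set.mem_empty_iff_false, false_and, iff_false,
      not_and]
    intro h hω
    exact mem_T_open hf a₂ hω h.1
  · ext ω
    simp only [Set.mem_inter_iff, mem_closedEdge, Set.mem_empty_iff_false, false_and, iff_false,
      not_and]
    intro h hω
    exact mem_connL_closed hf hleaf h13 hv hω h.2.1

omit [LinearOrder R] [IsStrictOrderedRing R] h12 in
/-- `P(T ∩ X ∩ {a₁ ↔ v}) = 0` (`v ≠ a₁`). -/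
lemma prob_T_inter_R {v : V} (hv : v ≠ a₁) (X : Set (Config E)) :
    prob p (TEvent ends a₁ a₂ a₃ ∩ (X ∩ connEvent ends a₁ v)) = 0 := by
  rw [Set.inter_comm X]
  exact prob_T_inter_L p hf hleaf h13 hv X

omit [LinearOrder R] [IsStrictOrderedRing R] h12 in
/-- `P(T ∩ {a₁ ↔ v}) = 0`. -/
lemma prob_T_inter_L₀ {v : V} (hv : v ≠ a₁) :
    prob p (TEvent ends a₁ a₂ a₃ ∩ connEvent ends a₁ v) = 0 := by
  have h := prob_T_inter_L p hf hleaf h13 (a₂ := a₂) hv Set.univ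
  simpa only [Set.inter_univ] using h

omit [LinearOrder R] [IsStrictOrderedRing R] in
/-- `P(T′ ∩ X) = q P(Q¹ ∩ X)` for free `X`. -/
lemma prob_T'_inter {X : Set (Config E)} (hX : Free f X) :
    prob p (TEvent ends a₂ a₁ a₃ ∩ X) = p f * prob p (avoidAll ends a₂ {a₃} ∩ X) := by
  have h := prob_split p (A := TEvent ends a₂ a₁ a₃ ∩ X)
    ((free_Q1 hf hleaf h13 h12).inter hX) (A₀ := ∅)
    (by intro ω ω' _; rfl) ?_ ?_
  · rw [h, prob_empty, mul_zero, add_zero]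
  · ext ω
    simp only [Set.mem_inter_iff, mem_openEdge]
    constructor <;> rintro ⟨h, hω⟩ <;>
      exact ⟨by simpa only [mem_T'_open hf a₂ hω] using h, hω⟩
  · ext ω
    simp only [Set.mem_inter_iff, mem_closedEdge, Set.mem_empty_iff_false, false_and, iff_false,
      not_and]
    intro h hω
    exact mem_T'_closed hf hleaf h13 a₂ hω h.1

omit [LinearOrder R] [IsStrictOrderedRing R] in
/-- `P(T′) = q Z`. -/
lemma prob_T' : prob p (TEvent ends a₂ a₁ a₃) = p f * prob p (avoidAll ends a₂ {a₃}) := by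
  have h := prob_T'_inter p hf hleaf h13 h12 (X := Set.univ) (by intro ω ω' _; rfl)
  simpa only [Set.inter_univ] using h

omit [LinearOrder R] [IsStrictOrderedRing R] in
/-- `P(T′ ∩ {a₁ ↔ v} ∩ X) = q P(Q¹ ∩ {a₃ ↔ v} ∩ X)` for free `X`, `v ≠ a₁`. -/
lemma prob_T'_inter_L {v : V} (hv : v ≠ a₁) {X : Set (Config E)} (hX : Free f X) :
    prob p (TEvent ends a₂ a₁ a₃ ∩ (connEvent ends a₁ v ∩ X)) =
      p f * prob p (avoidAll ends a₂ {a₃} ∩ (connEvent ends a₃ v ∩ X)) := by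
  have h := prob_split p (A := TEvent ends a₂ a₁ a₃ ∩ (connEvent ends a₁ v ∩ X))
    ((free_Q1 hf hleaf h13 h12).inter
      ((free_connEvent hf hleaf h13 h13.symm hv).inter hX)) (A₀ := ∅) (by intro ω ω' _; rfl) ?_ ?_
  · rw [h, prob_empty, mul_zero, add_zero]
  · ext ω
    simp only [Set.mem_inter_iff, mem_openEdge]
    constructor <;> rintro ⟨h, hω⟩ <;>
      exact ⟨by simpa only [mem_T'_open hf a₂ hω, mem_connL_open hf v hω] using h, hω⟩
  · ext ω
    simp only [Set.mem_inter_iff, mem_closedEdge, Set.mem_empty_iff_false, false_and, iff_false,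
      not_and]
    intro h hω
    exact mem_T'_closed hf hleaf h13 a₂ hω h.1

omit [LinearOrder R] [IsStrictOrderedRing R] in
/-- `P(T′ ∩ X ∩ {a₁ ↔ v}) = q P(Q¹ ∩ X ∩ {a₃ ↔ v})` for free `X`, `v ≠ a₁`. -/
lemma prob_T'_inter_R {v : V} (hv : v ≠ a₁) {X : Set (Config E)} (hX : Free f X) :
    prob p (TEvent ends a₂ a₁ a₃ ∩ (X ∩ connEvent ends a₁ v)) =
      p f * prob p (avoidAll ends a₂ {a₃} ∩ (X ∩ connEvent ends a₃ v)) := by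
  rw [Set.inter_comm X, Set.inter_comm X]
  exact prob_T'_inter_L p hf hleaf h13 h12 hv hX

omit [LinearOrder R] [IsStrictOrderedRing R] in
/-- `P(T′ ∩ {a₁ ↔ v}) = q P(Q¹ ∩ {a₃ ↔ v})`. -/
lemma prob_T'_inter_L₀ {v : V} (hv : v ≠ a₁) :
    prob p (TEvent ends a₂ a₁ a₃ ∩ connEvent ends a₁ v) =
      p f * prob p (avoidAll ends a₂ {a₃} ∩ connEvent ends a₃ v) := by
  have h := prob_T'_inter_L p hf hleaf h13 h12 hv (X := Set.univ) (by intro ω ω' _; rfl)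
  simpa only [Set.inter_univ] using h

omit [LinearOrder R] [IsStrictOrderedRing R] h12 in
/-- `P(a₁ ↔ v) = q P(a₃ ↔ v)` (`v ≠ a₁`). -/
lemma prob_conn_leaf {v : V} (hv : v ≠ a₁) :
    prob p (connEvent ends a₁ v) = p f * prob p (connEvent ends a₃ v) := by
  have h := prob_split p (A := connEvent ends a₁ v) (free_connEvent hf hleaf h13 h13.symm hv)
    (A₀ := ∅) (by intro ω ω' _; rfl) ?_ ?_
  · rw [h, prob_empty, mul_zero, add_zero]
  · ext ω
    simp only [Set.mem_inter_iff, mem_openEdge]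
    constructor <;> rintro ⟨h, hω⟩ <;> exact ⟨by simpa only [mem_connL_open hf v hω] using h, hω⟩
  · ext ω
    simp only [Set.mem_inter_iff, mem_closedEdge, Set.mem_empty_iff_false, false_and, iff_false,
      not_and]
    intro h hω
    exact mem_connL_closed hf hleaf h13 hv hω h


omit [LinearOrder R] [IsStrictOrderedRing R] in
/-- `P(Q ∩ {a₁ ↔ u} ∩ {a₁ ↔ v}) = q P(Q¹ ∩ {a₃ ↔ u} ∩ {a₃ ↔ v})` (`u, v ≠ a₁`). -/
lemma prob_Q_inter_LL {u v : V} (hu : u ≠ a₁) (hv : v ≠ a₁) :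
    prob p (avoidAll ends a₂ {a₁} ∩ (connEvent ends a₁ u ∩ connEvent ends a₁ v)) =
      p f * prob p (avoidAll ends a₂ {a₃} ∩ (connEvent ends a₃ u ∩ connEvent ends a₃ v)) := by
  have h := prob_split p (A := avoidAll ends a₂ {a₁} ∩ (connEvent ends a₁ u ∩ connEvent ends a₁ v))
    ((free_Q1 hf hleaf h13 h12).inter
      ((free_connEvent hf hleaf h13 h13.symm hu).inter (free_connEvent hf hleaf h13 h13.symm hv)))
    (A₀ := ∅) (by intro ω ω' _; rfl) ?_ ?_
  · rw [h, prob_empty, mul_zero, add_zero]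
  · ext ω
    simp only [Set.mem_inter_iff, mem_openEdge]
    constructor <;> rintro ⟨h, hω⟩ <;>
      exact ⟨by simpa only [mem_Q_open hf a₂ hω, mem_connL_open hf u hω,
        mem_connL_open hf v hω] using h, hω⟩
  · ext ω
    simp only [Set.mem_inter_iff, mem_closedEdge, Set.mem_empty_iff_false, false_and,
      iff_false, not_and]
    intro h hω
    exact mem_connL_closed hf hleaf h13 hu hω h.2.1

omit [LinearOrder R] [IsStrictOrderedRing R] in
/-- `P(T′ ∩ {a₁ ↔ u} ∩ {a₁ ↔ v}) = q P(Q¹ ∩ {a₃ ↔ u} ∩ {a₃ ↔ v})` (`u, v ≠ a₁`). -/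
lemma prob_T'_inter_LL {u v : V} (hu : u ≠ a₁) (hv : v ≠ a₁) :
    prob p (TEvent ends a₂ a₁ a₃ ∩ (connEvent ends a₁ u ∩ connEvent ends a₁ v)) =
      p f * prob p (avoidAll ends a₂ {a₃} ∩ (connEvent ends a₃ u ∩ connEvent ends a₃ v)) := by
  have h := prob_split p (A := TEvent ends a₂ a₁ a₃ ∩ (connEvent ends a₁ u ∩ connEvent ends a₁ v))
    ((free_Q1 hf hleaf h13 h12).inter
      ((free_connEvent hf hleaf h13 h13.symm hu).inter (free_connEvent hf hleaf h13 h13.symm hv)))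
    (A₀ := ∅) (by intro ω ω' _; rfl) ?_ ?_
  · rw [h, prob_empty, mul_zero, add_zero]
  · ext ω
    simp only [Set.mem_inter_iff, mem_openEdge]
    constructor <;> rintro ⟨h, hω⟩ <;>
      exact ⟨by simpa only [mem_T'_open hf a₂ hω, mem_connL_open hf u hω,
        mem_connL_open hf v hω] using h, hω⟩
  · ext ω
    simp only [Set.mem_inter_iff, mem_closedEdge, Set.mem_empty_iff_false, false_and,
      iff_false, not_and]
    intro h hω
    exact mem_T'_closed hf hleaf h13 a₂ hω h.1

end Atoms

/-! ## The decomposition of the free masses over `Q¹ ⊔ {a₂ ↔ a₃}` -/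

section Decomp

variable (p : E → R) (ends : E → Sym2 V) (a₂ a₃ : V)

omit [Fintype E] [DecidableEq E] [LinearOrder R] [IsStrictOrderedRing R] in
/-- `Q¹ = {a₂ ↔ a₃}ᶜ`. -/
lemma Q1_eq_compl : avoidAll ends a₂ {a₃} = (connEvent ends a₂ a₃)ᶜ := by
  rw [avoidAll_eq_compl, connEvent_comm]

omit [LinearOrder R] [IsStrictOrderedRing R] in
/-- `P(X) = P(Q¹ ∩ X) + P({a₂ ↔ a₃} ∩ X)`. -/
lemma prob_decomp (X : Set (Config E)) :
    prob p X = prob p (avoidAll ends a₂ {a₃} ∩ X) + prob p (connEvent ends a₂ a₃ ∩ X) := by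
  have h := prob_inter_add_prob_inter_compl p X (connEvent ends a₂ a₃)
  have e1 : avoidAll ends a₂ {a₃} ∩ X = X ∩ (connEvent ends a₂ a₃)ᶜ := by
    rw [Q1_eq_compl ends a₂ a₃, Set.inter_comm]
  have e2 : connEvent ends a₂ a₃ ∩ X = X ∩ connEvent ends a₂ a₃ := Set.inter_comm _ _
  rw [e1, e2]
  linear_combination -h

omit [LinearOrder R] [IsStrictOrderedRing R] in
/-- `P(Q¹) = 1 − P(a₂ ↔ a₃)`. -/
lemma prob_Q1 : prob p (avoidAll ends a₂ {a₃}) = 1 - prob p (connEvent ends a₂ a₃) := by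
  rw [Q1_eq_compl, prob_compl]

omit [Fintype E] [DecidableEq E] [LinearOrder R] [IsStrictOrderedRing R] in
/-- On `{a₂ ↔ a₃}`, `a₃ ↔ v` iff `a₂ ↔ v`. -/
lemma conn_inter_swap (v : V) :
    connEvent ends a₂ a₃ ∩ connEvent ends a₃ v = connEvent ends a₂ a₃ ∩ connEvent ends a₂ v := by
  ext ω
  simp only [Set.mem_inter_iff, mem_connEvent]
  constructor
  · rintro ⟨h23, h3v⟩; exact ⟨h23, conn_trans h23 h3v⟩
  · rintro ⟨h23, h2v⟩; exact ⟨h23, conn_trans (conn_symm h23) h2v⟩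

end Decomp


/-! ## The identity and the theorem -/

section Main

variable [Fintype V] [DecidableEq V] (p : E → R) (ends : E → Sym2 V)

omit [Fintype V] [DecidableEq V] [LinearOrder R] [IsStrictOrderedRing R] in
/-- **The root-leaf identity at `a₃`**: with the root `a₁` a leaf at `a₃` through `f` (`q = p f`),
`Z = P(a₃ ↮ a₂)` and the cleared covariances `C` of the roots `(a₃, a₂)`,
`Gc = 2 q (1 − q) (1 − q + q Z) · [C(oH, bH) − C(oH, bL)]`. -/
theorem Gc_root_leaf_a3 {f : E} {a₁ a₃ : V} (hf : ends f = s(a₁, a₃))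
    (hleaf : ∀ e, a₁ ∈ ends e → e = f) (h13 : a₁ ≠ a₃) {o a₂ b : V} (h12 : a₁ ≠ a₂)
    (ho : o ≠ a₁) (hb : b ≠ a₁) :
    Gc p ends o a₁ a₂ a₃ b =
      2 * p f * (1 - p f) * (1 - p f + p f * prob p (avoidAll ends a₂ {a₃})) *
        (covC p ends a₃ a₂ (connEvent ends a₂ o) (connEvent ends a₂ b) -
          covC p ends a₃ a₂ (connEvent ends a₂ o) (connEvent ends a₃ b)) := by
  have h21 : a₂ ≠ a₁ := Ne.symm h12
  have c₂o : Free f (connEvent ends a₂ o) := free_connEvent hf hleaf h13 h21 ho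
  have c₂b : Free f (connEvent ends a₂ b) := free_connEvent hf hleaf h13 h21 hb
  unfold Gc DEF EQbo EQb3 EQb3o EQo EQ3 EQ3o PDb PDbo Do gap covC
  rw [prob_Q p hf hleaf h13 h12, prob_univ,
    prob_Q_inter_LL p hf hleaf h13 h12 ho hb,
    prob_Q_inter p hf hleaf h13 h12 (c₂o.inter c₂b),
    prob_Q_inter_R p hf hleaf h13 h12 hb c₂o,
    prob_Q_inter_L p hf hleaf h13 h12 ho c₂b,
    prob_Q_inter_L₀ p hf hleaf h13 h12 ho, prob_Q_inter p hf hleaf h13 h12 c₂o,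
    prob_T'_inter_L₀ p hf hleaf h13 h12 hb, prob_T_inter p hf hleaf h13 h12 c₂b,
    prob_T_inter_L₀ p hf hleaf h13 hb, prob_T'_inter p hf hleaf h13 h12 c₂b,
    prob_T'_inter_LL p hf hleaf h13 h12 ho hb, prob_T'_inter_R p hf hleaf h13 h12 hb c₂o,
    prob_T_inter_L p hf hleaf h13 ho (connEvent ends a₂ b),
    prob_T_inter p hf hleaf h13 h12 (c₂o.inter c₂b),
    prob_T_inter_L p hf hleaf h13 ho (connEvent ends a₁ b),
    prob_T_inter_R p hf hleaf h13 hb (connEvent ends a₂ o),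
    prob_T'_inter_L p hf hleaf h13 h12 ho c₂b, prob_T'_inter p hf hleaf h13 h12 (c₂o.inter c₂b),
    prob_T' p hf hleaf h13 h12, prob_T p hf hleaf h13 h12,
    prob_T'_inter_L₀ p hf hleaf h13 h12 ho, prob_T'_inter p hf hleaf h13 h12 c₂o,
    prob_T_inter_L₀ p hf hleaf h13 ho, prob_T_inter p hf hleaf h13 h12 c₂o,
    prob_PD_inter_L₀ p hf hleaf h13 hb, prob_PD_inter p hf hleaf h13 h12 c₂b,
    prob_PD_inter_L p hf hleaf h13 ho (connEvent ends a₁ b),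
    prob_PD_inter_R p hf hleaf h13 hb (connEvent ends a₂ o),
    prob_PD_inter_L p hf hleaf h13 ho (connEvent ends a₂ b),
    prob_PD_inter p hf hleaf h13 h12 (c₂o.inter c₂b),
    prob_PD_inter_L₀ p hf hleaf h13 ho, prob_PD_inter p hf hleaf h13 h12 c₂o,
    prob_PD p hf hleaf h13 h12, prob_conn_leaf p hf hleaf h13 hb]
  -- decompose the free masses over `Q¹ ⊔ {a₂ ↔ a₃}`
  rw [prob_decomp p ends a₂ a₃ (connEvent ends a₂ o ∩ connEvent ends a₂ b),
    prob_decomp p ends a₂ a₃ (connEvent ends a₂ o), prob_decomp p ends a₂ a₃ (connEvent ends a₂ b),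
    prob_decomp p ends a₂ a₃ (connEvent ends a₃ b), conn_inter_swap, prob_Q1]
  ring

/-- **(HCOV) when the root `a₁` is a leaf at `a₃`**, for every weight of the leaf edge:
BHK06 Thm 1.3 on `C(a₂)` given `a₃ ∉ C(a₂)` (`C(oH, bH) ≥ 0`) and BHK06 Thm 1.4 cross cluster
(`C(oH, bL) ≤ 0`). -/
theorem HCov_root_leaf_a3 (hp : IsProbVec p) {f : E} {a₁ a₃ : V} (hf : ends f = s(a₁, a₃))
    (hleaf : ∀ e, a₁ ∈ ends e → e = f) (h13 : a₁ ≠ a₃) {o a₂ b : V} (h12 : a₁ ≠ a₂)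
    (ho : o ≠ a₁) (hb : b ≠ a₁) : HCov p ends o a₁ a₂ a₃ b := by
  unfold HCov
  rw [Gc_root_leaf_a3 p ends hf hleaf h13 h12 ho hb]
  -- the same-cluster covariance of the roots `(a₃, a₂)` is that of the roots `(a₂, a₃)`
  have hsym : avoidAll ends a₂ {a₃} = avoidAll ends a₃ {a₂} := by
    rw [avoidAll_eq_compl, avoidAll_eq_compl, connEvent_comm]
  have hsame : 0 ≤ covC p ends a₃ a₂ (connEvent ends a₂ o) (connEvent ends a₂ b) := by
    have h := covC_same_nonneg p ends hp o a₂ a₃ b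
    unfold covC at h ⊢
    rw [hsym]
    exact h
  have hcross := (covC_cross_nonpos p ends hp o a₃ a₂ b).1
  have hq0 := hp.nonneg f
  have hq1 := sub_nonneg.2 (hp.le_one f)
  have hZ := prob_nonneg hp (avoidAll ends a₂ {a₃})
  have hmix : 0 ≤ 1 - p f + p f * prob p (avoidAll ends a₂ {a₃}) :=
    add_nonneg hq1 (mul_nonneg hq0 hZ)
  have hbr : 0 ≤ covC p ends a₃ a₂ (connEvent ends a₂ o) (connEvent ends a₂ b) -
      covC p ends a₃ a₂ (connEvent ends a₂ o) (connEvent ends a₃ b) := by linarith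
  exact mul_nonneg (mul_nonneg (mul_nonneg (mul_nonneg (by norm_num) hq0) hq1) hmix) hbr

/-- **(HCOV) when the root `a₂` is a leaf at `a₃`** (by the root symmetry `Gc_swap`). -/
theorem HCov_root_leaf_a3' (hp : IsProbVec p) {f : E} {a₂ a₃ : V} (hf : ends f = s(a₂, a₃))
    (hleaf : ∀ e, a₂ ∈ ends e → e = f) (h23 : a₂ ≠ a₃) {o a₁ b : V} (h21 : a₂ ≠ a₁)
    (ho : o ≠ a₂) (hb : b ≠ a₂) : HCov p ends o a₁ a₂ a₃ b := by
  exact (HCov_swap p ends o a₁ a₂ a₃ b).1 (HCov_root_leaf_a3 p ends hp hf hleaf h23 h21 ho hb)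

end Main

end RootLeafA3

end Summit.Ventures.PercRepro2
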